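import Summits.BirchSwinnertonDyer.BirchSwinnertonDyer.Theorems.ResidualThetaTransportAtTwoSignedMuSeedAtTwoPlusTiltFormalGroup
import Literature.NumberTheory.EllipticCurves.FormalGroupLawAxiomsUniversalProofs
import Literature.NumberTheory.EllipticCurves.FormalMulTwoLowOrderProofs
import HarnessLib

/-!
# `F(t₁, t₂) = t₁ + t₂ + t₁²t₂² + O(deg 5)` for the formal group law of `y² + y = x³` in characteristic `2`
# — the one formal-group input of stub J4 of the seed line `jet-character-sums` that was not yet typed
# (crux `SignedMuSeedAtTwoPlus` stmt-BirchSwinnertonDyer-21438; Kμ⁺ stmt-BirchSwinnertonDyer-20689; route `ResidualThetaTransportAtTwo`)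

Cell `bsd-wall`, width seat `bsd-wall-rtt-p4-w2` g13 (`--supports`, closes nothing).  THEOREMS ONLY (no `def`, no named fact, no instance,
no `sorry`); nothing about any habitat curve is asserted; the line is NOT registered (W-79); BSD is not proved by this.

The line card `Cruxes/SignedMuSeedAtTwoPlus/Lines/jet-character-sums.md` (J4 `LevelOneWallCriterion`, «Leans on») lists the formal-group facts
«`F = t₁ + t₂ + t₁²t₂² + O(deg 5)` with `F_y(t,0) = 1 + O(t⁶)`, `[−2]t = t⁴`, `[−1]t = t + t⁴ + t¹⁰ + …`» for `Ẽ : y² + y = x³`; the last two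
are kernel theorems (`…TiltCurve` / `…JetFormalInverse`); `JetKernel.md` v2 (w2 g12) records the first as «NOT typed — degree-4 chord-construction
coefficients absent». This file proves it for the TREE's chord–tangent law `WeierstrassCurve.formalGroupLaw` (`FormalGroupLaw.lean`, AEC IV.1):

* §1 (every Weierstrass curve, every commutative ring) `coeff_formalGroupLaw_swap` — `[z₀^i z₁^j] F = [z₀^j z₁^i] F` (from the tree's
  `formalGroupLaw_comm'`); `coeff_formalMul_two_eq_sum_antidiagonal` — `[tⁿ] [2](t) = Σ_{i+j=n} [z₀^i z₁^j] F` (`[2](t) = F(t, t)`).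
* §2 (`Ẽ = ⟨0,0,1,0,0⟩`, characteristic `2`) `X_zero_sq_dvd_formalGroupLaw_sub'` — `z₀² ∣ F − z₁ − z₀` (the tree's `z₀`-adic expansion
  `F = z₁ + z₀ η(z₁) + z₀² H` with `η = 1`, `formalEta_eq_one`), hence with §1 **`coeff_formalGroupLaw_eq_zero_off_corner`**: every coefficient
  `[z₀^i z₁^j] F` with `i + j ≥ 2` and `min(i, j) ≤ 1` vanishes, i.e. **`F = z₀ + z₁ + z₀²z₁²·H`** (`X_zero_sq_mul_X_one_sq_dvd_formalGroupLaw_sub`)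
  — in particular `F_y(t, 0) = 1` EXACTLY (not only `+ O(t⁶)`).
* §3 the corner coefficient: `[z₀²z₁²] F = [t⁴] [2](t) = a₁a₂ − 7a₃ = −7 = 1` (tree `coeff_four_formalMul_two`, AEC IV.2.3), so
  **`coeff_formalGroupLaw_of_degree_le_four`**: for `i + j ≤ 4`, `[z₀^i z₁^j] F = 1` iff `(i,j) ∈ {(1,0), (0,1), (2,2)}`, else `0` —
  the card's «`F = t₁ + t₂ + t₁²t₂² + O(deg 5)`», also packaged as `five_le_order_formalGroupLaw_sub`
  (`ord(F − (z₀ + z₁ + z₀²z₁²)) ≥ 5` for Mathlib's total-degree `MvPowerSeries.order`).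

References: [SilvermanAEC2009] IV.1 (chord–tangent law), IV.2.3 (`[2](z) = 2z − a₁z² − 2a₂z³ + (a₁a₂ − 7a₃)z⁴ + ⋯`); the card (stub J4).
-/

set_option autoImplicit false
-- the Theorems namespace of this sub repeats the summit name by design (D-0017 nested layout)
set_option linter.dupNamespace false

noncomputable section

open scoped Classical
open PowerSeries Finset

namespace Summit.BirchSwinnertonDyer.BirchSwinnertonDyer.Theorems.SignedMuAtTwo.JetCharacterSums

/-! ## §1 Coefficient bookkeeping valid for every Weierstrass curve over every commutative ring -/

section AnyCurve

variable {R : Type*} [CommRing R] (W : WeierstrassCurve R)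

/-- The monomial `z₁^i · z₀^j` has exactly one non-zero coefficient. [folklore] -/
theorem coeff_X_one_pow_mul_X_zero_pow (i j : ℕ) (d : Fin 2 →₀ ℕ) :
    MvPowerSeries.coeff d ((MvPowerSeries.X 1 : MvPowerSeries (Fin 2) R) ^ i * MvPowerSeries.X 0 ^ j) =
      if d = Finsupp.single 1 i + Finsupp.single 0 j then 1 else 0 := by
  rw [MvPowerSeries.X_pow_eq, MvPowerSeries.X_pow_eq, MvPowerSeries.monomial_mul_monomial, one_mul,
    MvPowerSeries.coeff_monomial]

/-- **Symmetry of the coefficients of the formal group law**: `[z₀^i z₁^j] F = [z₀^j z₁^i] F` for every Weierstrass curve over every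
commutative ring (the tree's `formalGroupLaw_comm'`: `F(z₁, z₀) = F(z₀, z₁)`). [cite: SilvermanAEC2009, IV.2.1] -/
theorem coeff_formalGroupLaw_swap (d : Fin 2 →₀ ℕ) :
    MvPowerSeries.coeff (Finsupp.single 0 (d 1) + Finsupp.single 1 (d 0)) W.formalGroupLaw =
      MvPowerSeries.coeff d W.formalGroupLaw := by
  have hb0 : ∀ j : Fin 2, MvPowerSeries.constantCoeff
      ((![(MvPowerSeries.X 1 : MvPowerSeries (Fin 2) R), MvPowerSeries.X 0]) j) = 0 := by
    intro j; fin_cases j <;> simp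
  have hbs : MvPowerSeries.HasSubst ![(MvPowerSeries.X 1 : MvPowerSeries (Fin 2) R), MvPowerSeries.X 0] :=
    MvPowerSeries.hasSubst_of_constantCoeff_zero hb0
  conv_rhs => rw [← W.formalGroupLaw_comm', MvPowerSeries.coeff_subst hbs]
  rw [finsum_eq_single _ (Finsupp.single 0 (d 1) + Finsupp.single 1 (d 0))]
  · have hprod : (Finsupp.single (0 : Fin 2) (d 1) + Finsupp.single 1 (d 0)).prod
        (fun s m => (![(MvPowerSeries.X 1 : MvPowerSeries (Fin 2) R), MvPowerSeries.X 0]) s ^ m) =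
        (MvPowerSeries.X 1 : MvPowerSeries (Fin 2) R) ^ (d 1) * MvPowerSeries.X 0 ^ (d 0) := by
      rw [Finsupp.prod_pow, Fin.prod_univ_two]
      simp
    rw [hprod, coeff_X_one_pow_mul_X_zero_pow, if_pos, smul_eq_mul, mul_one]
    ext i; fin_cases i <;> simp
  · intro e he
    have hprod : e.prod (fun s m => (![(MvPowerSeries.X 1 : MvPowerSeries (Fin 2) R), MvPowerSeries.X 0]) s ^ m) =
        (MvPowerSeries.X 1 : MvPowerSeries (Fin 2) R) ^ (e 0) * MvPowerSeries.X 0 ^ (e 1) := by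
      rw [Finsupp.prod_pow, Fin.prod_univ_two]
      simp
    rw [hprod, coeff_X_one_pow_mul_X_zero_pow, if_neg, smul_zero]
    intro hde
    apply he
    ext i; fin_cases i
    · simpa using (congrArg (fun f => f 1) hde).symm
    · simpa using (congrArg (fun f => f 0) hde).symm

/-- **`[tⁿ] [2](t) = Σ_{i+j=n} [z₀^i z₁^j] F`** (`[2](t) = F(t, t)`, the tree's `formalMul_two`), for every Weierstrass curve over every
commutative ring. [cite: SilvermanAEC2009, IV.2.3] -/
theorem coeff_formalMul_two_eq_sum_antidiagonal (n : ℕ) :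
    coeff n (W.formalMul 2) =
      ∑ ij ∈ antidiagonal n, MvPowerSeries.coeff (Finsupp.single 0 ij.1 + Finsupp.single 1 ij.2) W.formalGroupLaw := by
  have hb0 : ∀ j : Fin 2, MvPowerSeries.constantCoeff ((![(X : R⟦X⟧), X]) j) = 0 := by
    intro j; fin_cases j <;> exact PowerSeries.constantCoeff_X
  have hbs : MvPowerSeries.HasSubst ![(X : R⟦X⟧), X] := MvPowerSeries.hasSubst_of_constantCoeff_zero hb0
  have hprod : ∀ e : Fin 2 →₀ ℕ, e.prod (fun s m => (![(X : R⟦X⟧), X]) s ^ m) = X ^ (e 0 + e 1) := by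
    intro e
    rw [Finsupp.prod_pow, Fin.prod_univ_two, pow_add]
    simp
  rw [W.formalMul_two, PowerSeries.coeff, MvPowerSeries.coeff_subst hbs]
  simp_rw [hprod]
  rw [finsum_eq_sum_of_support_subset _ (s := (antidiagonal n).image
    fun ij => Finsupp.single (0 : Fin 2) ij.1 + Finsupp.single 1 ij.2)]
  · rw [Finset.sum_image]
    · refine Finset.sum_congr rfl fun ij hij => ?_
      rw [HasAntidiagonal.mem_antidiagonal] at hij
      have h01 : (Finsupp.single (0 : Fin 2) ij.1 + Finsupp.single 1 ij.2 : Fin 2 →₀ ℕ) 0 +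
          (Finsupp.single (0 : Fin 2) ij.1 + Finsupp.single 1 ij.2 : Fin 2 →₀ ℕ) 1 = n := by
        simp only [Finsupp.coe_add, Pi.add_apply, Finsupp.single_eq_same, Finsupp.single_eq_of_ne (zero_ne_one' (Fin 2)),
          Finsupp.single_eq_of_ne (zero_ne_one' (Fin 2)).symm, add_zero, zero_add, hij]
      have hc : MvPowerSeries.coeff (Finsupp.single () n) ((X : R⟦X⟧) ^
          ((Finsupp.single (0 : Fin 2) ij.1 + Finsupp.single 1 ij.2 : Fin 2 →₀ ℕ) 0 +
            (Finsupp.single (0 : Fin 2) ij.1 + Finsupp.single 1 ij.2 : Fin 2 →₀ ℕ) 1)) = 1 := by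
        rw [show MvPowerSeries.coeff (Finsupp.single () n) = PowerSeries.coeff (R := R) n from rfl, coeff_X_pow, if_pos h01.symm]
      rw [hc, smul_eq_mul, mul_one]
    · intro ij _ ij' _ h
      have h0 := congrArg (fun f => f 0) h
      have h1 := congrArg (fun f => f 1) h
      simp only [Finsupp.coe_add, Pi.add_apply, Finsupp.single_eq_same, Finsupp.single_eq_of_ne (zero_ne_one' (Fin 2)),
        Finsupp.single_eq_of_ne (zero_ne_one' (Fin 2)).symm, add_zero, zero_add] at h0 h1
      exact Prod.ext h0 h1
  · intro e he
    rw [Function.mem_support] at he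
    rw [Finset.coe_image, Set.mem_image]
    refine ⟨(e 0, e 1), ?_, ?_⟩
    · rw [Finset.mem_coe, HasAntidiagonal.mem_antidiagonal]
      by_contra hne
      apply he
      rw [show MvPowerSeries.coeff (Finsupp.single () n) = PowerSeries.coeff (R := R) n from rfl, coeff_X_pow, if_neg (Ne.symm hne),
        smul_zero]
    · ext i; fin_cases i <;> simp

end AnyCurve

/-! ## §2 `Ẽ : y² + y = x³` in characteristic `2`: `F = z₀ + z₁ + z₀²z₁²·H` -/

section TiltCurve

variable (k : Type*) [CommRing k] [CharP k 2]

/-- Two exponent vectors in two variables agree iff their two entries agree. [folklore] -/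
theorem finsupp_fin_two_eq_iff (d e : Fin 2 →₀ ℕ) : d = e ↔ d 0 = e 0 ∧ d 1 = e 1 := by
  constructor
  · rintro rfl; exact ⟨rfl, rfl⟩
  · rintro ⟨h0, h1⟩; ext i; fin_cases i; exacts [h0, h1]

/-- `z₀² ∣ F − z₁ − z₀` for `Ẽ = (y² + y = x³)` in characteristic `2`: the tree's `z₀`-adic expansion `F = z₁ + z₀·η(z₁) + z₀²·H`
(`X_zero_sq_dvd_formalGroupLaw_sub`) with `η = 1` (`formalEta_eq_one`). [cite: SilvermanAEC2009, IV.1.1] -/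
theorem X_zero_sq_dvd_formalGroupLaw_sub' :
    (MvPowerSeries.X 0 : MvPowerSeries (Fin 2) k) ^ 2 ∣
      (⟨0, 0, 1, 0, 0⟩ : WeierstrassCurve k).formalGroupLaw - MvPowerSeries.X 1 - MvPowerSeries.X 0 := by
  have h := Tilt.X_zero_sq_dvd_formalGroupLaw_sub (⟨0, 0, 1, 0, 0⟩ : WeierstrassCurve k)
  rw [Tilt.formalEta_eq_one _ rfl rfl rfl rfl, ← map_one (C (R := k)), PowerSeries.subst_C, map_one, mul_one] at h
  exact h

/-- Coefficients `[z₀^i z₁^j] F` with `i ≤ 1`: only `[z₀] F = [z₁] F = 1` survive (`Ẽ = (y² + y = x³)`, characteristic `2`).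
[cite: SilvermanAEC2009, IV.1.1] -/
theorem coeff_formalGroupLaw_of_apply_zero_lt_two (d : Fin 2 →₀ ℕ) (hd : d 0 < 2) :
    MvPowerSeries.coeff d (⟨0, 0, 1, 0, 0⟩ : WeierstrassCurve k).formalGroupLaw = if d 0 + d 1 = 1 then 1 else 0 := by
  have h := (MvPowerSeries.X_pow_dvd_iff.mp (X_zero_sq_dvd_formalGroupLaw_sub' k)) d hd
  rw [map_sub, map_sub, sub_eq_zero, sub_eq_iff_eq_add, MvPowerSeries.coeff_X, MvPowerSeries.coeff_X] at h
  have e0 : (d = Finsupp.single 0 1) ↔ (d 0 = 1 ∧ d 1 = 0) := by rw [finsupp_fin_two_eq_iff]; simp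
  have e1 : (d = Finsupp.single 1 1) ↔ (d 0 = 0 ∧ d 1 = 1) := by rw [finsupp_fin_two_eq_iff]; simp
  rw [h]
  by_cases hA : d 0 = 1 ∧ d 1 = 0
  · rw [if_pos (e0.mpr hA), if_neg (mt e1.mp (by omega)), if_pos (by omega), add_zero]
  · by_cases hB : d 0 = 0 ∧ d 1 = 1
    · rw [if_neg (mt e0.mp hA), if_pos (e1.mpr hB), if_pos (by omega), zero_add]
    · rw [if_neg (mt e0.mp hA), if_neg (mt e1.mp hB), if_neg (by omega), add_zero]

/-- Coefficients `[z₀^i z₁^j] F` with `j ≤ 1`: only `[z₀] F = [z₁] F = 1` survive (by the symmetry `coeff_formalGroupLaw_swap`).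
[cite: SilvermanAEC2009, IV.1.1] -/
theorem coeff_formalGroupLaw_of_apply_one_lt_two (d : Fin 2 →₀ ℕ) (hd : d 1 < 2) :
    MvPowerSeries.coeff d (⟨0, 0, 1, 0, 0⟩ : WeierstrassCurve k).formalGroupLaw = if d 0 + d 1 = 1 then 1 else 0 := by
  rw [← coeff_formalGroupLaw_swap, coeff_formalGroupLaw_of_apply_zero_lt_two k _ (by simpa using hd)]
  simp only [Finsupp.coe_add, Pi.add_apply, Finsupp.single_eq_same, Finsupp.single_eq_of_ne (zero_ne_one' (Fin 2)),
    Finsupp.single_eq_of_ne (zero_ne_one' (Fin 2)).symm, zero_add, add_comm (d 1)]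

/-- **Off-corner vanishing: `[z₀^i z₁^j] F = 0` whenever `i + j ≥ 2` and `min(i, j) ≤ 1`** — i.e. `F = z₀ + z₁ + z₀²z₁²·H(z₀, z₁)` for
`Ẽ = (y² + y = x³)` in characteristic `2` (so `F_y(t, 0) = 1` exactly). [cite: SilvermanAEC2009, IV.1.1] -/
theorem coeff_formalGroupLaw_eq_zero_off_corner (d : Fin 2 →₀ ℕ) (h2 : 2 ≤ d 0 + d 1) (hmin : d 0 < 2 ∨ d 1 < 2) :
    MvPowerSeries.coeff d (⟨0, 0, 1, 0, 0⟩ : WeierstrassCurve k).formalGroupLaw = 0 := by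
  rcases hmin with h | h
  · rw [coeff_formalGroupLaw_of_apply_zero_lt_two k d h, if_neg (by omega)]
  · rw [coeff_formalGroupLaw_of_apply_one_lt_two k d h, if_neg (by omega)]

/-- **`z₀²z₁² ∣ F − (z₀ + z₁)`** for `Ẽ = (y² + y = x³)` in characteristic `2`. [cite: SilvermanAEC2009, IV.1.1] -/
theorem X_zero_sq_mul_X_one_sq_dvd_formalGroupLaw_sub :
    (MvPowerSeries.X 0 : MvPowerSeries (Fin 2) k) ^ 2 * MvPowerSeries.X 1 ^ 2 ∣
      (⟨0, 0, 1, 0, 0⟩ : WeierstrassCurve k).formalGroupLaw - (MvPowerSeries.X 0 + MvPowerSeries.X 1) := by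
  obtain ⟨G, hG⟩ : (MvPowerSeries.X 0 : MvPowerSeries (Fin 2) k) ^ 2 ∣
      (⟨0, 0, 1, 0, 0⟩ : WeierstrassCurve k).formalGroupLaw - (MvPowerSeries.X 0 + MvPowerSeries.X 1) := by
    have h := X_zero_sq_dvd_formalGroupLaw_sub' k
    rwa [sub_sub, add_comm (MvPowerSeries.X 1)] at h
  rw [hG]
  refine mul_dvd_mul_left _ (MvPowerSeries.X_pow_dvd_iff.mpr fun m hm => ?_)
  have hm0 : (m + Finsupp.single 0 2 : Fin 2 →₀ ℕ) 0 = m 0 + 2 := by simp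
  have hm1 : (m + Finsupp.single 0 2 : Fin 2 →₀ ℕ) 1 = m 1 := by simp
  have hc := coeff_formalGroupLaw_eq_zero_off_corner k (m + Finsupp.single 0 2) (by omega) (Or.inr (by omega))
  have hc' : MvPowerSeries.coeff (m + Finsupp.single 0 2)
      ((⟨0, 0, 1, 0, 0⟩ : WeierstrassCurve k).formalGroupLaw - (MvPowerSeries.X 0 + MvPowerSeries.X 1)) = 0 := by
    rw [map_sub, map_add, hc, MvPowerSeries.coeff_X, MvPowerSeries.coeff_X, if_neg, if_neg]
    · simp
    · rw [finsupp_fin_two_eq_iff, hm0]; simp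
    · rw [finsupp_fin_two_eq_iff, hm0]; simp
  rw [hG, show m + Finsupp.single (0 : Fin 2) 2 = Finsupp.single 0 2 + m from add_comm _ _, MvPowerSeries.X_pow_eq,
    MvPowerSeries.coeff_monomial_mul, if_pos le_self_add, add_tsub_cancel_left, one_mul] at hc'
  exact hc'

/-! ## §3 The corner coefficient `[z₀²z₁²] F = 1` and the `4`-jet -/

/-- **`[z₀²z₁²] F = 1`** for `Ẽ = (y² + y = x³)` in characteristic `2`: `[t⁴] [2](t) = a₁a₂ − 7a₃ = −7 = 1` (tree
`coeff_four_formalMul_two`, AEC IV.2.3) and `[t⁴] [2](t) = Σ_{i+j=4} [z₀^i z₁^j] F = [z₀²z₁²] F` (off-corner vanishing).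
[cite: SilvermanAEC2009, IV.2.3] -/
theorem coeff_two_two_formalGroupLaw :
    MvPowerSeries.coeff (Finsupp.single 0 2 + Finsupp.single 1 2) (⟨0, 0, 1, 0, 0⟩ : WeierstrassCurve k).formalGroupLaw = 1 := by
  have h4 := (⟨0, 0, 1, 0, 0⟩ : WeierstrassCurve k).coeff_four_formalMul_two
  rw [coeff_formalMul_two_eq_sum_antidiagonal, Finset.Nat.sum_antidiagonal_eq_sum_range_succ_mk] at h4
  simp only [Finset.sum_range_succ, Finset.sum_range_zero, zero_add, Nat.sub_zero, Nat.sub_self,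
    show 4 - 1 = 3 from rfl, show 4 - 2 = 2 from rfl, show 4 - 3 = 1 from rfl] at h4
  rw [coeff_formalGroupLaw_eq_zero_off_corner k (Finsupp.single 0 0 + Finsupp.single 1 4) (by simp) (Or.inl (by simp)),
    coeff_formalGroupLaw_eq_zero_off_corner k (Finsupp.single 0 1 + Finsupp.single 1 3) (by simp) (Or.inl (by simp)),
    coeff_formalGroupLaw_eq_zero_off_corner k (Finsupp.single 0 3 + Finsupp.single 1 1) (by simp) (Or.inr (by simp)),
    coeff_formalGroupLaw_eq_zero_off_corner k (Finsupp.single 0 4 + Finsupp.single 1 0) (by simp) (Or.inr (by simp))] at h4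
  simp only [zero_add, add_zero, mul_zero, zero_sub, mul_one] at h4
  rw [h4]
  have h2 : (2 : k) = 0 := CharTwo.two_eq_zero
  linear_combination (-4 : k) * h2

/-- **`F(z₀, z₁) = z₀ + z₁ + z₀²z₁² + O(deg 5)`** for the chord–tangent formal group law of `Ẽ = (y² + y = x³)` in characteristic `2`:
every coefficient of total degree `≤ 4` is `0` except `[z₀] F = [z₁] F = [z₀²z₁²] F = 1` — the input of stub J4 of the line card.
[cite: SilvermanAEC2009, IV.1.1] -/
theorem coeff_formalGroupLaw_of_degree_le_four (d : Fin 2 →₀ ℕ) (hd : d 0 + d 1 ≤ 4) :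
    MvPowerSeries.coeff d (⟨0, 0, 1, 0, 0⟩ : WeierstrassCurve k).formalGroupLaw =
      if d 0 + d 1 = 1 ∨ (d 0 = 2 ∧ d 1 = 2) then 1 else 0 := by
  by_cases hc : d 0 = 2 ∧ d 1 = 2
  · have hd' : d = Finsupp.single 0 2 + Finsupp.single 1 2 := by rw [finsupp_fin_two_eq_iff]; simpa using hc
    rw [hd', coeff_two_two_formalGroupLaw, if_pos (Or.inr (by simp))]
  have hmin : d 0 < 2 ∨ d 1 < 2 := by omega
  rcases hmin with h | h
  · rw [coeff_formalGroupLaw_of_apply_zero_lt_two k d h]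
    by_cases h' : d 0 + d 1 = 1
    · rw [if_pos h', if_pos (Or.inl h')]
    · rw [if_neg h', if_neg (not_or.mpr ⟨h', hc⟩)]
  · rw [coeff_formalGroupLaw_of_apply_one_lt_two k d h]
    by_cases h' : d 0 + d 1 = 1
    · rw [if_pos h', if_pos (Or.inl h')]
    · rw [if_neg h', if_neg (not_or.mpr ⟨h', hc⟩)]

/-- The same `4`-jet packaged with the tree's total-degree order: **`ord(F − (z₀ + z₁ + z₀²z₁²)) ≥ 5`**. [cite: SilvermanAEC2009, IV.1.1] -/
theorem five_le_order_formalGroupLaw_sub :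
    (5 : ℕ∞) ≤ ((⟨0, 0, 1, 0, 0⟩ : WeierstrassCurve k).formalGroupLaw -
      (MvPowerSeries.X 0 + MvPowerSeries.X 1 + MvPowerSeries.X 0 ^ 2 * MvPowerSeries.X 1 ^ 2)).order := by
  refine MvPowerSeries.le_order fun d hd => ?_
  have hsum : Finsupp.degree d = d 0 + d 1 := by rw [Finsupp.degree_eq_sum, Fin.sum_univ_two]
  have hdeg' : d 0 + d 1 < 5 := by rw [← hsum]; exact_mod_cast hd
  have e22 : (d = Finsupp.single 0 2 + Finsupp.single 1 2) ↔ (d 0 = 2 ∧ d 1 = 2) := by rw [finsupp_fin_two_eq_iff]; simp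
  have e0 : (d = Finsupp.single 0 1) ↔ (d 0 = 1 ∧ d 1 = 0) := by rw [finsupp_fin_two_eq_iff]; simp
  have e1 : (d = Finsupp.single 1 1) ↔ (d 0 = 0 ∧ d 1 = 1) := by rw [finsupp_fin_two_eq_iff]; simp
  rw [map_sub, map_add, map_add, coeff_formalGroupLaw_of_degree_le_four k d (by omega), MvPowerSeries.coeff_X,
    MvPowerSeries.coeff_X, MvPowerSeries.X_pow_eq, MvPowerSeries.X_pow_eq, MvPowerSeries.monomial_mul_monomial, one_mul,
    MvPowerSeries.coeff_monomial, sub_eq_zero]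
  by_cases hA : d 0 = 1 ∧ d 1 = 0
  · rw [if_pos (Or.inl (by omega)), if_pos (e0.mpr hA), if_neg (mt e1.mp (by omega)), if_neg (mt e22.mp (by omega))]; ring
  by_cases hB : d 0 = 0 ∧ d 1 = 1
  · rw [if_pos (Or.inl (by omega)), if_neg (mt e0.mp hA), if_pos (e1.mpr hB), if_neg (mt e22.mp (by omega))]; ring
  by_cases hC : d 0 = 2 ∧ d 1 = 2
  · rw [if_pos (Or.inr hC), if_neg (mt e0.mp hA), if_neg (mt e1.mp hB), if_pos (e22.mpr hC)]; ring
  rw [if_neg (by omega), if_neg (mt e0.mp hA), if_neg (mt e1.mp hB), if_neg (mt e22.mp hC)]; ring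

end TiltCurve

end Summit.BirchSwinnertonDyer.BirchSwinnertonDyer.Theorems.SignedMuAtTwo.JetCharacterSums

end
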